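import Summits.AtomisticToContinuum.HydrodynamicLimit.Theorems.AprioriBounds.Negative.BlockDensityAveraging
import Summits.AtomisticToContinuum.HydrodynamicLimit.Theorems.AprioriBounds.Negative.AdmissibleKernel
import Summits.AtomisticToContinuum.HydrodynamicLimit.Theorems.AprioriBounds.Negative.FccPacking
import Literature.Analysis.FluidPDE.HardSphereAlexander

/-!
# `AprioriBounds` (stmt-AtomisticToContinuum-9519), negative knowledge 4/7: (ii) is false without its smallness threshold

Load-bearing analysis of the crux `CollisionIsometryCLT.AprioriBounds` (shared verbatim with
`StiffCollisionalRelaxation.AprioriBounds`) by the standing disprover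
(`Cruxes/AprioriBounds/Disproof.lean`, refuter-cdisprove-stmt-AtomisticToContinuum-9519-0).

HEADLINE (`aprioriBoundsII_false_without_small_sigma`, UNCONDITIONAL): the statement
`AprioriBoundsIIWithoutSmallSigma` — component (ii) of the crux for the homogeneous profile
(`a₀ = θ₀ = 1`, `u₀ = 0`) with the threshold `σ < σ₀` replaced by the sub-close-packing range
`σ⁶ < 2` (where the laws are probability measures infinitely often, file 3/4), stated along TAIL flow
families `N ↦ Φ_{N₀+N}` (the conclusion is asymptotic in `N`; Alexander's theorem as typed inhabits
the flow types exactly where `hsDiameter < 1/2`, i.e. for all large `N`), everything else verbatim —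
is FALSE.  Witness: `σ = 21/20` (`σ³ ≈ 1.158 > 1`, `σ⁶ ≈ 1.34 < 2`), `N₀ = 9`, Alexander's flows,
`t = 1`, the mollifier kernels of file 2/4; along `N₀ + N + 1 = 4m³` the law has mass `1` (file 3/4)
while the bad event is everything (file 1/4), so its probability is `1` infinitely often.

VERBATIM PER-σ FORM (`aprioriBoundsIIAt_false`): at every `σ` with `1 < σ³`, `σ⁶ < 2`, the body of
the crux after its `σ`-quantifiers (`AprioriBoundsIIAt σ`, second conjunct, verbatim) is false for
the homogeneous profile and ANY flow family, given only that a flow family exists at that `σ`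
(`nonempty_flowFamily`: reducible to the `≤ 9` smallest `N`, a typing gap — two-body billiards on
`𝕋³` with `ε > 1/2` — not a mathematical doubt).  Read on the crux (`aprioriBounds_sigma0_le_one`):
modulo those small-`N` flows, EVERY threshold `σ₀` valid for the homogeneous profile is `≤ 1`.

MESSAGE: any proof of (ii) must use `σ < σ₀` with `σ₀ ≤ 1` before any dynamics enters (mean block
density `≡ 1 ≤ σ⁻³`); and every witness has `c₁ ≤ 1`.  The crux itself is NOT refuted: off
equilibrium nothing beyond energy/momentum conservation and Liouville invariance is available (see
the Disproof workfile for the physical, unlandable post-collapse counterexample — Guderley's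
reflected phase — and the repair `t < T_classical`).

Maintenance record (full-build repair, 2026-08-17; dependency drift, content unchanged).
`aprioriBoundsIIAt_of_aprioriBounds` and `aprioriBounds_sigma0_le_one` take the hypothesis
`(h : Summit.AtomisticToContinuum.HydrodynamicLimit.Theses.CollisionIsometryCLT.AprioriBounds)`
(stmt-AtomisticToContinuum-9519, the `∀ t > 0` form), spelled fully qualified.  Route rev 12/13
(2026-08-16T06:37Z) retired 9519 and restated the crux in pre-shock form
(`CollisionIsometryCLT.AprioriBoundsPreShock`; in route `StiffCollisionalRelaxation` the name
`AprioriBounds` now denotes that pre-shock restatement, stmt-14827, a DIFFERENT proposition), after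
which the gate-generated thesis module no longer declares the identifier and this file (and its
importers `Cruxes/AprioriBounds/Lines/{stiff_localised_povzner,visit_ledger_upscattering}.lean`, which
name the same identifier) stopped elaborating.  Repair: the retired statement is RECORDED below under
its exact former name, `Summit.AtomisticToContinuum.HydrodynamicLimit.Theses.CollisionIsometryCLT.AprioriBounds`,
with its text VERBATIM (the ledger signature of stmt-9519; token-identical to the gate-written decl
`StiffRelaxation.AprioriBounds`, stmt-AtomisticToContinuum-7231, to the record `Retired9519.AprioriBounds`
of `AprioriBoundsFalseOfPersistentVacuum.lean`, p132090, and to the record of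
`Cruxes/AprioriBounds/Disproof.lean`), so every signature and proof below is byte-for-byte the landed
one (p76565) and reads as before.  Same repair pattern as `AprioriBoundsFalseOfPersistentVacuum.lean`
(local record) and `Theorems/CoherentStatesAssembly3.lean` of summit AnomalousDissipation (record under
the retired route name).
-/

noncomputable section

open MeasureTheory Filter Set Topology
open scoped ENNReal

/-! ## Record of the retired crux statement (stmt-AtomisticToContinuum-9519, the `∀ t > 0` form) -/

namespace Summit.AtomisticToContinuum.HydrodynamicLimit.Theses.CollisionIsometryCLT

/-- **RECORD of the retired crux `CollisionIsometryCLT.AprioriBounds` (stmt-AtomisticToContinuum-9519,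
the `∀ t > 0` form; verbatim its ledger signature), under its former name.**  The route declaration was
RETIRED at route rev 12/13 (2026-08-16: dedup into the pre-shock restatement stmt-14827 =
`…Theses.StiffCollisionalRelaxation.AprioriBounds` = `…Theses.CollisionIsometryCLT.AprioriBoundsPreShock`)
and the gate-generated thesis module no longer declares it; the theorems of this file
(`aprioriBoundsIIAt_of_aprioriBounds`, `aprioriBounds_sigma0_le_one`) and of its importers name it fully
qualified, so its text is kept HERE, token-identical to the still-live gate-written decl
`…Theses.StiffRelaxation.AprioriBounds` (stmt-AtomisticToContinuum-7231) and to
`AprioriBoundsNegative.Retired9519.AprioriBounds`: for all continuous profiles `a₀, θ₀ > 0`, `u₀` there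
is `σ₀ > 0` such that for all `0 < σ < σ₀`, every flow family `Φ` and EVERY `t > 0`: (i) a
time-averaged one-particle exponential velocity moment on `[0, t]` is bounded w.h.p.; (ii) for every
admissible kernel family (`γ ≤ 1/15`) some `c₁ > 0` floors all block densities, and `ρ̄σ³ ≤ 1`, at all
times `s ≤ t`, w.h.p.  A record (definition), not a cited fact and not a route item. -/
def AprioriBounds : Prop :=
  ∀ (a₀ θ₀ : (UnitAddTorus (Fin 3)) → ℝ) (u₀ : (UnitAddTorus (Fin 3)) → (EuclideanSpace ℝ (Fin 3))), Continuous a₀ → Continuous θ₀ → Continuous u₀ → (∀ x, 0 < a₀ x) → (∀ x, 0 < θ₀ x) → ∃ σ₀ : ℝ, 0 < σ₀ ∧ ∀ σ : ℝ, 0 < σ → σ < σ₀ → ∀ Φ : (N : ℕ) → Literature.Analysis.FluidPDE.HardSphereFlow (Literature.Analysis.FluidPDE.Torus.geometry (Fin 3)) (Literature.MathematicalPhysics.KineticTheory.hsDiameter σ N) (N + 1), ∀ t : ℝ, 0 < t → (∃ lam Cexp : ℝ, 0 < lam ∧ Tendsto (fun N : ℕ => Literature.MathematicalPhysics.KineticTheory.localGibbsLaw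 σ a₀ u₀ θ₀ N (Φ N) {z | Cexp < ∫ s in Icc 0 t, ∫ y, Real.exp (lam * ‖y.2‖ ^ 2) ∂(Literature.Analysis.FluidPDE.empiricalMeasure ((Φ N).flow s z))}) atTop (𝓝 0)) ∧ (∀ (γ C : ℝ) (φ : ℕ → (UnitAddTorus (Fin 3)) → ℝ), 0 < γ → γ ≤ 1 / 15 → ((∀ N, Literature.Analysis.FunctionSpaces.Torus.IsSmooth (φ N)) ∧ (∀ N y, 0 ≤ φ N y) ∧ (∀ N, ∫ y, φ N y = 1) ∧ (∀ (N : ℕ) y, ((N : ℝ) + 1) ^ (-γ) ≤ Literature.Analysis.FluidPDE.Torus.euclidDist y 0 → φ N y = 0) ∧ (∀ (N : ℕ) y, φ N y ≤ C * ((N : ℝ) + 1) ^ (3 * γ)) ∧ (∀ (N : ℕ) y, ‖Literature.Analysis.FunctionSpaces.Torus.gradient (φ N) y‖ ≤ C * ((N : ℝ) + 1) ^ (4 * γ))) → ∃ c₁ : ℝ, 0 < c₁ ∧ Tendsto (fun N : ℕ => Literature.MathematicalPhysics.KineticTheory.localGibbsLaw σ a₀ u₀ θ₀ N (Φ N) {z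 | ∃ s ∈ Icc 0 t, ∃ x : (UnitAddTorus (Fin 3)), Literature.MathematicalPhysics.KineticTheory.empiricalDensityField ((Φ N).flow s z) (fun y => φ N (y - x)) < c₁ ∨ 1 < Literature.MathematicalPhysics.KineticTheory.empiricalDensityField ((Φ N).flow s z) (fun y => φ N (y - x)) * σ ^ 3}) atTop (𝓝 0))

end Summit.AtomisticToContinuum.HydrodynamicLimit.Theses.CollisionIsometryCLT

namespace Summit.AtomisticToContinuum.HydrodynamicLimit.Theorems

namespace AprioriBoundsNegative

open Literature.MathematicalPhysics.KineticTheory Literature.Analysis.FluidPDE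

/-- Component (ii) of the crux AT a given `σ` and given profiles (the body of `AprioriBounds` after
the `σ`-quantifiers, second conjunct only), verbatim. -/
def AprioriBoundsIIAt (σ : ℝ) (a₀ θ₀ : T3 → ℝ) (u₀ : T3 → V3) : Prop :=
  ∀ Φ : (N : ℕ) → HardSphereFlow (Torus.geometry (Fin 3)) (hsDiameter σ N) (N + 1),
    ∀ t : ℝ, 0 < t → ∀ (γ C : ℝ) (φ : ℕ → T3 → ℝ), 0 < γ → γ ≤ 1 / 15 →
      ((∀ N, Literature.Analysis.FunctionSpaces.Torus.IsSmooth (φ N)) ∧ (∀ N y, 0 ≤ φ N y) ∧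
        (∀ N, ∫ y, φ N y = 1) ∧
        (∀ (N : ℕ) y, ((N : ℝ) + 1) ^ (-γ) ≤ Torus.euclidDist y 0 → φ N y = 0) ∧
        (∀ (N : ℕ) y, φ N y ≤ C * ((N : ℝ) + 1) ^ (3 * γ)) ∧
        (∀ (N : ℕ) y, ‖Literature.Analysis.FunctionSpaces.Torus.gradient (φ N) y‖ ≤
          C * ((N : ℝ) + 1) ^ (4 * γ))) →
      ∃ c₁ : ℝ, 0 < c₁ ∧ Tendsto (fun N : ℕ => localGibbsLaw σ a₀ u₀ θ₀ N (Φ N)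
        {z | ∃ s ∈ Icc 0 t, ∃ x : T3,
          empiricalDensityField ((Φ N).flow s z) (fun y => φ N (y - x)) < c₁ ∨
            1 < empiricalDensityField ((Φ N).flow s z) (fun y => φ N (y - x)) * σ ^ 3})
        atTop (𝓝 0)

/-- `AprioriBounds` hands out, for every admissible profile, a threshold `σ₀` below which
`AprioriBoundsIIAt σ` holds (projection `.2` of the crux; pure logic). -/
theorem aprioriBoundsIIAt_of_aprioriBounds
    (h : Summit.AtomisticToContinuum.HydrodynamicLimit.Theses.CollisionIsometryCLT.AprioriBounds)
    (a₀ θ₀ : T3 → ℝ) (u₀ : T3 → V3) (ha : Continuous a₀) (hθ : Continuous θ₀) (hu : Continuous u₀)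
    (ha0 : ∀ x, 0 < a₀ x) (hθ0 : ∀ x, 0 < θ₀ x) :
    ∃ σ₀ : ℝ, 0 < σ₀ ∧ ∀ σ : ℝ, 0 < σ → σ < σ₀ → AprioriBoundsIIAt σ a₀ θ₀ u₀ := by
  obtain ⟨σ₀, hσ₀, hσ⟩ := h a₀ θ₀ u₀ ha hθ hu ha0 hθ0
  exact ⟨σ₀, hσ₀, fun σ h0 h1 Φ t ht γ C φ hγ hγ' hadm => (hσ σ h0 h1 Φ t ht).2 γ C φ hγ hγ' hadm⟩

/-- **The homogeneous laws keep full mass infinitely often at every `σ⁶ < 2`** (FCC along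
`N + 1 = 4(a+1)³`, file 3/4). -/
theorem densePackingMass_of_pow_six_lt_two {σ : ℝ} (hσ6 : σ ^ 6 < 2) :
    ∃ᶠ N in atTop, ∀ Φ : HardSphereFlow (Torus.geometry (Fin 3)) (hsDiameter σ N) (N + 1),
      localGibbsLaw σ (fun _ => 1) (fun _ => 0) (fun _ => 1) N Φ univ = 1 := by
  rw [Filter.frequently_atTop]
  intro a
  have hP : a + 1 ≤ (a + 1) ^ 3 := Nat.le_self_pow three_ne_zero (a + 1)
  refine ⟨4 * (a + 1) ^ 3 - 1, ?_, fun Φ => localGibbsLaw_univ_fcc hσ6 (Nat.succ_pos a) ?_ Φ⟩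
  · generalize (a + 1) ^ 3 = P at *
    omega
  · generalize (a + 1) ^ 3 = P at *
    omega

/-! ## Conclusion: (ii) fails at every `1 < σ³`, `σ⁶ < 2`; the dilute threshold is `≤ 1` -/

/-- **(ii) is false at every `σ` with `σ³ > 1` at which the laws keep mass** (homogeneous profile,
ANY flow family): the bad event is all of phase space (file 1/4) and its probability is `1` infinitely
often.  `hΦ` = a flow family exists at this `σ` (see `nonempty_flowFamily`). -/
theorem aprioriBoundsIIAt_false_of_mass {σ : ℝ} (hσ : 1 < σ ^ 3)
    (hmass : ∃ᶠ N in atTop, ∀ Φ : HardSphereFlow (Torus.geometry (Fin 3)) (hsDiameter σ N) (N + 1),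
      localGibbsLaw σ (fun _ => 1) (fun _ => 0) (fun _ => 1) N Φ univ = 1)
    (hΦ : Nonempty ((N : ℕ) → HardSphereFlow (Torus.geometry (Fin 3)) (hsDiameter σ N) (N + 1))) :
    ¬ AprioriBoundsIIAt σ (fun _ => 1) (fun _ => 1) (fun _ => 0) := by
  intro h
  obtain ⟨Φ⟩ := hΦ
  obtain ⟨γ, C, φ, hγ, hγ', hsm, hnn, hone, hsupp, hsup, hgrad, hint⟩ := exists_admissibleKernelFamily
  obtain ⟨c₁, -, hT⟩ := h Φ 1 one_pos γ C φ hγ hγ' ⟨hsm, hnn, hone, hsupp, hsup, hgrad⟩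
  refine not_tendsto_zero_of_frequently_univ (fun N => localGibbsLaw σ (fun _ => 1) (fun _ => 0)
    (fun _ => 1) N (Φ N))
    (fun N => {z | ∃ s ∈ Icc 0 1, ∃ x : T3,
      empiricalDensityField ((Φ N).flow s z) (fun y => φ N (y - x)) < c₁ ∨
        1 < empiricalDensityField ((Φ N).flow s z) (fun y => φ N (y - x)) * σ ^ 3})
    (fun N => badEventII_eq_univ_of_one_lt_sigma_cube hσ (Φ N) (hint N) (hone N) zero_le_one c₁)
    (hmass.mono fun N hN => hN (Φ N)) ?_
  exact hT

/-- **Load-bearing smallness, unconditional form**: at every `σ` with `1 < σ³` and `σ⁶ < 2`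
component (ii) of the crux is FALSE for the homogeneous profile and ANY flow family — given only
that a flow family exists at this `σ` (`hΦ`; Alexander covers all `N` with `hsDiameter σ N < 1/2`,
see `nonempty_flowFamily`). -/
theorem aprioriBoundsIIAt_false {σ : ℝ} (hσ3 : 1 < σ ^ 3) (hσ6 : σ ^ 6 < 2)
    (hΦ : Nonempty ((N : ℕ) → HardSphereFlow (Torus.geometry (Fin 3)) (hsDiameter σ N) (N + 1))) :
    ¬ AprioriBoundsIIAt σ (fun _ => 1) (fun _ => 1) (fun _ => 0) :=
  aprioriBoundsIIAt_false_of_mass hσ3 (densePackingMass_of_pow_six_lt_two hσ6) hΦ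

/-- A flow family exists as soon as flows exist for the finitely many `N` with
`hsDiameter σ N ≥ 1/2` (the others come from Alexander's theorem on the torus,
`HardSphereFlow.nonempty_torus_holds`).  For `σ ≤ 21/20` these are `N + 1 ≤ 9`. -/
theorem nonempty_flowFamily {σ : ℝ} (hσ : 0 < σ)
    (hsmall : ∀ N : ℕ, 2⁻¹ ≤ hsDiameter σ N →
      Nonempty (HardSphereFlow (Torus.geometry (Fin 3)) (hsDiameter σ N) (N + 1))) :
    Nonempty ((N : ℕ) → HardSphereFlow (Torus.geometry (Fin 3)) (hsDiameter σ N) (N + 1)) := by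
  classical
  exact ⟨fun N => if h : hsDiameter σ N < 2⁻¹ then
    (HardSphereFlow.nonempty_torus_holds (hsDiameter_pos hσ N) h (N + 1)).some
    else (hsmall N (not_lt.mp h)).some⟩

/-- **Corollary (the dilute threshold of (ii) is `≤ 1`).** Any `σ₀` below which (ii) holds for the
homogeneous profile satisfies `σ₀ ≤ 1` — provided flow families exist at the `σ ∈ (1, 21/20]`
used as witnesses (`hΦ`, reducible to `N + 1 ≤ 9` by `nonempty_flowFamily`).  However the dynamics
behave, (ii)'s upper bound `ρ̄σ³ ≤ 1` pins the admissible range to `σ ≤ 1` (mean density `1`);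
harmless for the intended `σ₀ ≪ 1`, but it shows the bound is a constraint on `σ₀` before it is
one on the dynamics. -/
theorem sigma0_le_one_of_aprioriBoundsIIAt_witness
    (hΦ : ∀ σ : ℝ, 1 < σ → σ ≤ 21 / 20 →
      Nonempty ((N : ℕ) → HardSphereFlow (Torus.geometry (Fin 3)) (hsDiameter σ N) (N + 1)))
    {σ₀ : ℝ} (hσ₀ : ∀ σ : ℝ, 0 < σ → σ < σ₀ → AprioriBoundsIIAt σ (fun _ => 1) (fun _ => 1) (fun _ => 0)) :
    σ₀ ≤ 1 := by
  by_contra hlt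
  have hlt : 1 < σ₀ := not_le.mp hlt
  set σ : ℝ := min ((1 + σ₀) / 2) (21 / 20) with hσdef
  have hσgt : 1 < σ := by
    rw [hσdef, lt_min_iff]; constructor <;> linarith
  have hσlt : σ < σ₀ := lt_of_le_of_lt (min_le_left _ _) (by linarith)
  have hσle : σ ≤ 21 / 20 := min_le_right _ _
  have hσ3 : 1 < σ ^ 3 := by
    have := pow_lt_pow_left₀ hσgt zero_le_one (n := 3) three_ne_zero
    simpa using this
  have hσ6 : σ ^ 6 < 2 := by
    have h0 : (0 : ℝ) ≤ σ := by linarith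
    have := pow_le_pow_left₀ h0 hσle 6
    have h2 : ((21 : ℝ) / 20) ^ 6 < 2 := by norm_num
    linarith
  exact aprioriBoundsIIAt_false hσ3 hσ6 (hΦ σ hσgt hσle) (hσ₀ σ (by linarith) hσlt)

/-- The same corollary read on the crux: the threshold `σ₀` that `AprioriBounds` hands to the
homogeneous profile is `≤ 1`. -/
theorem aprioriBounds_sigma0_le_one
    (h : Summit.AtomisticToContinuum.HydrodynamicLimit.Theses.CollisionIsometryCLT.AprioriBounds)
    (hΦ : ∀ σ : ℝ, 1 < σ → σ ≤ 21 / 20 →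
      Nonempty ((N : ℕ) → HardSphereFlow (Torus.geometry (Fin 3)) (hsDiameter σ N) (N + 1))) :
    ∃ σ₀ : ℝ, 0 < σ₀ ∧ σ₀ ≤ 1 ∧ ∀ σ : ℝ, 0 < σ → σ < σ₀ →
      AprioriBoundsIIAt σ (fun _ => 1) (fun _ => 1) (fun _ => 0) := by
  obtain ⟨σ₀, hσ₀, hw⟩ := aprioriBoundsIIAt_of_aprioriBounds h (fun _ => 1) (fun _ => 1)
    (fun _ => 0) continuous_const continuous_const continuous_const (fun _ => one_pos)
    (fun _ => one_pos)
  exact ⟨σ₀, hσ₀, sigma0_le_one_of_aprioriBoundsIIAt_witness hΦ hw, hw⟩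

/-! ## Unconditional form along tail flow families -/

/-- **(ii) without the smallness threshold, tail form.**  Component (ii) of the crux for the
homogeneous profile (`a₀ = θ₀ = 1`, `u₀ = 0`), with the threshold `σ < σ₀` replaced by the whole
sub-close-packing range `σ⁶ < 2` (where the laws are probability measures infinitely often, §3b), and
stated along TAIL flow families `N ↦ Φ_{N₀+N}` — the conclusion is asymptotic in `N`, and Alexander's
theorem as typed inhabits the flow types exactly for `hsDiameter < 1/2`, i.e. for all large `N`.
Everything else (kernel admissibility, the bad event, `Tendsto … (𝓝 0)`) is verbatim. -/
def AprioriBoundsIIWithoutSmallSigma : Prop :=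
  ∀ σ : ℝ, 0 < σ → σ ^ 6 < 2 → ∀ N₀ : ℕ,
    ∀ Φ : (N : ℕ) → HardSphereFlow (Torus.geometry (Fin 3)) (hsDiameter σ (N₀ + N)) (N₀ + N + 1),
    ∀ t : ℝ, 0 < t → ∀ (γ C : ℝ) (φ : ℕ → T3 → ℝ), 0 < γ → γ ≤ 1 / 15 →
      ((∀ N, Literature.Analysis.FunctionSpaces.Torus.IsSmooth (φ N)) ∧ (∀ N y, 0 ≤ φ N y) ∧
        (∀ N, ∫ y, φ N y = 1) ∧
        (∀ (N : ℕ) y, ((N : ℝ) + 1) ^ (-γ) ≤ Torus.euclidDist y 0 → φ N y = 0) ∧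
        (∀ (N : ℕ) y, φ N y ≤ C * ((N : ℝ) + 1) ^ (3 * γ)) ∧
        (∀ (N : ℕ) y, ‖Literature.Analysis.FunctionSpaces.Torus.gradient (φ N) y‖ ≤
          C * ((N : ℝ) + 1) ^ (4 * γ))) →
      ∃ c₁ : ℝ, 0 < c₁ ∧ Tendsto (fun N : ℕ =>
        localGibbsLaw σ (fun _ => 1) (fun _ => 0) (fun _ => 1) (N₀ + N) (Φ N)
        {z | ∃ s ∈ Icc 0 t, ∃ x : T3,
          empiricalDensityField ((Φ N).flow s z) (fun y => φ (N₀ + N) (y - x)) < c₁ ∨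
            1 < empiricalDensityField ((Φ N).flow s z) (fun y => φ (N₀ + N) (y - x)) * σ ^ 3})
        atTop (𝓝 0)

/-- At `σ = 21/20` and `N ≥ 9` the particle diameter is below `1/2` (so Alexander's theorem applies):
`(21/20)·(10+N)^{-1/3} < 1/2` since `(21/10)³ < 10`. -/
theorem hsDiameter_lt_half_tail (N : ℕ) : hsDiameter (21 / 20) (9 + N) < 2⁻¹ := by
  set r : ℝ := ((9 + N + 1 : ℕ) : ℝ) ^ (1 / 3 : ℝ) with hr
  have hN1 : (0 : ℝ) < ((9 + N + 1 : ℕ) : ℝ) := by positivity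
  have hr0 : 0 < r := Real.rpow_pos_of_pos hN1 _
  have h3 : r ^ (3 : ℕ) = ((9 + N + 1 : ℕ) : ℝ) := by
    rw [hr, show (1 / 3 : ℝ) = ((3 : ℕ) : ℝ)⁻¹ by norm_num,
      Real.rpow_inv_natCast_pow hN1.le (by norm_num)]
  have h10 : (10 : ℝ) ≤ r ^ 3 := by
    rw [h3]; push_cast; linarith [(Nat.cast_nonneg N : (0 : ℝ) ≤ N)]
  have hε : hsDiameter (21 / 20) (9 + N) = 21 / 20 / r := by
    rw [hsDiameter, hr, Real.rpow_neg hN1.le]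
    exact (div_eq_mul_inv _ _).symm
  rw [hε, div_lt_iff₀ hr0]
  -- `21/20 < r/2` iff `21/10 < r`, and `(21/10)³ = 9.261 < 10 ≤ r³`
  have h21 : (21 / 10 : ℝ) < r := by
    by_contra hle
    have hle : r ≤ 21 / 10 := not_lt.mp hle
    have := pow_le_pow_left₀ hr0.le hle 3
    nlinarith
  linarith

/-- **¬ (ii)-without-smallness, UNCONDITIONAL.**  Witness: `σ = 21/20` (`σ³ ≈ 1.158 > 1`,
`σ⁶ ≈ 1.34 < 2`), `N₀ = 9`, Alexander's flows, `t = 1`, the torus-mollifier kernel family; along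
`N₀ + N + 1 = 4m³` the law has mass `1` (FCC) while the bad event is everything (averaging identity),
so the probability is `1` infinitely often and does not tend to `0`, whatever `c₁`. -/
theorem aprioriBoundsII_false_without_small_sigma : ¬ AprioriBoundsIIWithoutSmallSigma := by
  intro h
  have hσ0 : (0 : ℝ) < 21 / 20 := by norm_num
  have hσ3 : (1 : ℝ) < (21 / 20) ^ 3 := by norm_num
  have hσ6 : ((21 : ℝ) / 20) ^ 6 < 2 := by norm_num
  set Φ : (N : ℕ) → HardSphereFlow (Torus.geometry (Fin 3)) (hsDiameter (21 / 20) (9 + N)) (9 + N + 1) :=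
    fun N => (HardSphereFlow.nonempty_torus_holds (hsDiameter_pos hσ0 (9 + N))
      (hsDiameter_lt_half_tail N) (9 + N + 1)).some with hΦ
  obtain ⟨γ, C, φ, hγ, hγ', hsm, hnn, hone, hsupp, hsup, hgrad, hint⟩ := exists_admissibleKernelFamily
  obtain ⟨c₁, -, hT⟩ := h (21 / 20) hσ0 hσ6 9 Φ 1 one_pos γ C φ hγ hγ' ⟨hsm, hnn, hone, hsupp, hsup, hgrad⟩
  refine not_tendsto_zero_of_frequently_univ
    (fun N => localGibbsLaw (21 / 20) (fun _ => 1) (fun _ => 0) (fun _ => 1) (9 + N) (Φ N))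
    (fun N => {z | ∃ s ∈ Icc 0 1, ∃ x : T3,
      empiricalDensityField ((Φ N).flow s z) (fun y => φ (9 + N) (y - x)) < c₁ ∨
        1 < empiricalDensityField ((Φ N).flow s z) (fun y => φ (9 + N) (y - x)) * (21 / 20) ^ 3})
    (fun N => badEventII_eq_univ_of_one_lt_sigma_cube hσ3 (Φ N) (hint (9 + N)) (hone (9 + N))
      zero_le_one c₁) ?_ hT
  -- mass one infinitely often along `9 + N + 1 = 4 (a+2)³`
  rw [Filter.frequently_atTop]
  intro a
  have hP : a + 2 ≤ (a + 2) ^ 3 := Nat.le_self_pow three_ne_zero (a + 2)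
  have hP8 : 8 ≤ (a + 2) ^ 3 := by
    calc 8 = 2 ^ 3 := by norm_num
      _ ≤ (a + 2) ^ 3 := Nat.pow_le_pow_left (by omega) 3
  refine ⟨4 * (a + 2) ^ 3 - 10, ?_, localGibbsLaw_univ_fcc hσ6 (show 0 < a + 2 by omega) ?_ (Φ _)⟩
  · generalize (a + 2) ^ 3 = P at *
    omega
  · generalize (a + 2) ^ 3 = P at *
    omega

end AprioriBoundsNegative

end Summit.AtomisticToContinuum.HydrodynamicLimit.Theorems

end
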